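import Summits.QuantumFields.YangMills.Theses.DirichletWindow
import Summits.QuantumFields.YangMills.Theorems.SoloBlindExpMoment
import HarnessLib

/-!
# `DirichletWindow.PlaquetteVarianceUpper` (item stmt-QuantumFields-8939) from four named inputs — the chessboard second-moment wiring

Sorry-free REDUCTION (seat ym-idea-4, gen 4, LINE-2 «chessboard-second-moment»): the route item
`Summit.QuantumFields.YangMills.Theses.DirichletWindow.PlaquetteVarianceUpper` (`f_β(0) = Var_μ(Re tr r(U_p)) ≤ B/β²` for every
torus-limit state, every compact simple `G`) follows from the four `Prop`s below, each of which is a composition of theorems already in the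
tree (no new mechanism):
* `EvenSecondMoment` — even tori: the Fröhlich–Israel–Lieb–Simon chessboard for the full one-orientation plaquette array
  (`WilsonPlaquetteTail.integral_plaquette_le_rpow_sites`, [FILS78, Thm 4.3]) with `f = exp((β/2)(N − Re tr ρ ·))` and the domination of the
  one-orientation energy by the Wilson action: `⟨(βφ_p)²⟩_{Λ_L,β} ≤ 8·exp(L⁻⁴(log Z_L(β/2) − log Z_L(β)))`;
* `UniformSecondMoment` — with the odd-torus twin `SoloBlind.wilsonExpectation_sq_mul_plaquetteCost_le` ([OS78, §§2–3]), the free-energy constant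
  term `DirichletWindow.FreeEnergyLogCoefficient_holds` (item 8759, closed; [Ch16, Thm 2.1] shape) and `exists_hasFreeEnergyDensity_holds`:
  `⟨(βφ_p)²⟩ ≤ C` for `β ≥ β₁`, eventually in the side, both parities;
* `LimitSecondMoment` — passage to every `μ ∈ infiniteVolumeLimitPoints` (bounded continuous cylinder observable);
* `VarianceLeSecondMoment` — `Var X ≤ E(X − N)²`.
The composition `plaquetteVarianceUpper_of` is elementary ([folklore]).  With `FixedDistanceLowerPsdTransfer.fixedDistanceLower_of` (item 8938) and
the landed door `xiDivergesOfFixedDistance_proof` this makes `DirichletWindow.XiDiverges` (item 8941) provable modulo the named inputs.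
No rung or summit statement is proved here.

References: [FILS78] J. Fröhlich, R. Israel, E. H. Lieb, B. Simon, Comm. Math. Phys. 62 (1978) 1–34, Thm 4.3; [OS78] K. Osterwalder,
E. Seiler, Ann. Phys. 110 (1978) 440–471; [Ch16] S. Chatterjee, arXiv:1602.01222, Thm 2.1.
-/

set_option autoImplicit false

open MeasureTheory Filter Topology
open Literature.MathematicalPhysics.QuantumFieldTheory
open Literature.MathematicalPhysics.QuantumLattice

namespace Summit.QuantumFields.YangMills.Theorems.PlaquetteVarianceUpperChessboard

/-- INPUT 1 — even-torus chessboard second moment of one `(0,a)`-plaquette cost, finite volume, every compact `G` (shape of [FILS78, Thm 4.3]). -/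
def EvenSecondMoment : Prop :=
  ∀ (G : Type) [Group G] [TopologicalSpace G] [IsTopologicalGroup G] [CompactSpace G] [MeasurableSpace G] [BorelSpace G]
    (r : LatticeRep G) (L : ℕ) [NeZero L], Even L → ∀ β : ℝ, 0 ≤ β → ∀ (x : Site 4 L) (a : Fin 4), a ≠ 0 →
      wilsonExpectation r.ρ β (fun U : GaugeConfig 4 L G =>
          (β * Summit.QuantumFields.YangMills.Theorems.SoloBlind.plaquetteCost r.ρ x 0 a U) ^ 2) ≤
        8 * Real.exp ((1 : ℝ) / (L : ℝ) ^ 4 * (torusLogPartition 4 r.ρ (β / 2) L - torusLogPartition 4 r.ρ β L))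

/-- INPUT 2 — β-uniform second moment on ALL large tori (both parities), every compact simple `G`. -/
def UniformSecondMoment : Prop :=
  ∀ (G : Type) [Group G] [TopologicalSpace G] [IsTopologicalGroup G] [CompactSpace G] [MeasurableSpace G] [BorelSpace G],
    IsCompactSimpleLieGroup G → ∀ r : LatticeRep G, ∃ C β₁ : ℝ, ∀ β : ℝ, β₁ ≤ β → ∀ᶠ L : ℕ in atTop,
      ∀ x : Site 4 (L + 1), wilsonExpectation r.ρ β (fun U : GaugeConfig 4 (L + 1) G =>
          (β * Summit.QuantumFields.YangMills.Theorems.SoloBlind.plaquetteCost r.ρ x 0 1 U) ^ 2) ≤ C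

/-- INPUT 3 — the same bound for every infinite-volume torus-limit state. -/
def LimitSecondMoment : Prop :=
  ∀ (G : Type) [Group G] [TopologicalSpace G] [IsTopologicalGroup G] [CompactSpace G] [MeasurableSpace G] [BorelSpace G],
    IsCompactSimpleLieGroup G → ∀ r : LatticeRep G, ∃ C β₁ : ℝ, ∀ β : ℝ, β₁ ≤ β →
      ∀ μ ∈ infiniteVolumeLimitPoints (d := 4) r.ρ β,
        ∫ U, (β * ((r.N : ℝ) - plaquetteObs r.ρ 0 0 1 U)) ^ 2 ∂μ ≤ C

/-- INPUT 4 — the variance is at most the second moment about `N`. -/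
def VarianceLeSecondMoment : Prop :=
  ∀ (G : Type) [Group G] [TopologicalSpace G] [IsTopologicalGroup G] [CompactSpace G] [MeasurableSpace G] [BorelSpace G]
    (r : LatticeRep G) (β : ℝ), ∀ μ ∈ infiniteVolumeLimitPoints (d := 4) r.ρ β,
      plaquetteCorrFn r.ρ μ 0 ≤ ∫ U, ((r.N : ℝ) - plaquetteObs r.ρ 0 0 1 U) ^ 2 ∂μ

/-- **Composition (kernel-checked):** the four inputs give `PlaquetteVarianceUpper` (item stmt-QuantumFields-8939) BY NAME. -/
theorem plaquetteVarianceUpper_of (h1 : EvenSecondMoment) (h2 : EvenSecondMoment → UniformSecondMoment)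
    (h3 : UniformSecondMoment → LimitSecondMoment) (h4 : VarianceLeSecondMoment) :
    Summit.QuantumFields.YangMills.Theses.DirichletWindow.PlaquetteVarianceUpper := by
  intro G _ _ _ _ _ _ hG r
  obtain ⟨C, β₁, hC⟩ := h3 (h2 h1) G hG r
  refine ⟨C, max β₁ 1, fun β hβ μ hμ => ?_⟩
  have hβ1 : 1 ≤ β := le_trans (le_max_right _ _) hβ
  have hβpos : 0 < β := lt_of_lt_of_le one_pos hβ1
  have hmom := hC β (le_trans (le_max_left _ _) hβ) μ hμ
  have hvar := h4 G r β μ hμ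
  have hscale : ∫ U, (β * ((r.N : ℝ) - plaquetteObs r.ρ 0 0 1 U)) ^ 2 ∂μ =
      β ^ 2 * ∫ U, ((r.N : ℝ) - plaquetteObs r.ρ 0 0 1 U) ^ 2 ∂μ := by
    rw [← integral_const_mul]
    congr 1
    funext U
    ring
  rw [hscale] at hmom
  rw [le_div_iff₀ (by positivity)]
  calc plaquetteCorrFn r.ρ μ 0 * β ^ 2
      ≤ (∫ U, ((r.N : ℝ) - plaquetteObs r.ρ 0 0 1 U) ^ 2 ∂μ) * β ^ 2 :=
        mul_le_mul_of_nonneg_right hvar (by positivity)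
    _ = β ^ 2 * ∫ U, ((r.N : ℝ) - plaquetteObs r.ρ 0 0 1 U) ^ 2 ∂μ := by ring
    _ ≤ C := hmom

end Summit.QuantumFields.YangMills.Theorems.PlaquetteVarianceUpperChessboard
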